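import Mathlib
import Literature.Probability.LatticeModels.ThermodynamicLimit
import Literature.Probability.LatticeModels.SharpnessProofs
import Summits.CriticalPhenomena.Ising3DConformalLimit.Theorems.PrecisionLaplacianDirectCorrelationStableTailSymbolIdentificationAux
import HarnessLib

/-!
# Stub `stub_symbolIdentification` of line `diffusive-branch-is-nonsaturation` (crux
# `PrecisionLaplacian.DirectCorrelationStableTail`, stmt-CriticalPhenomena-4799) — auxiliary file 2:
# the core estimate at a fixed nonzero momentum

Lead prover-line-stmt-CriticalPhenomena-4799-c4-0 (2026-08-17).  Pure theorem file (no definitions, no `sorry`).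

`symId_core` (registered sub-goal `stub_symbolIdentification_auxCore`, explicit binders): fix `k ≠ 0`, put
`Λ = C_α|k|₂^{-α}`; with the tightness data (at `∞` and at `0`), the scale identity of `stub_scaleIdentity` (as a
hypothesis), the kernel estimate of `stub_kernelScaling` and the Riesz–Gaussian package of `stub_rieszGaussian` at
this `k`, for every `δ > 0` and all large `R`:  `|c Λ R^α Σ_y m(y)(1 − cos(k·y/R)) − 1| ≤ δ`.

Proof.  Choose `ε₄ = δ/(3(K₂+1))`, `K₂ = c(C'+C)`, and the Riesz–Gaussian scale `t₀(ε₄)`; choose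
`τ₀ = max(2, 3(K₃+1)/δ)`, `K₃ = c(B+2Λ)C2^α`, and `t = min(t₀/2, τ₀^{-4})`, so that `τ = t^{-1/4} ≥ τ₀ ≥ 2` and
`K₃τ^{-α} ≤ δ/3`; choose `ε₃ = δ/(3(K₁+1))`, `K₁ = C'+C`, and `R₀(ε₃)` from the kernel estimate.  For `R ≥ max(R₀,R₁,1)`:
the scale identity gives `Σ_y m(y)(Ψ_R(0) − Ψ_R(y)) = 1`, so `cΛψ_R − 1 = Σ_y Z(y)` with
`Z = cΛR^α m(1 − cos) − m(Ψ_R(0) − Ψ_R)`; by the three-region bound (`symId_pointwise`) and the kernel estimate,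
`|Z(y)| ≤ m(y)[cR^α bnd(y) + R^α ε₃ min(|y/R|₂²,1)]`; summing over any box with the two mass estimates
(`symId_sum_bnd_le`, `symId_sum_min_le`) gives `Σ_{box L}|Z| ≤ K₂ε₄ + K₃τ^{-α} + K₁ε₃ ≤ δ`, and box exhaustion
(`symId_abs_tsum_le_of_sum_box_le`) concludes.  References: folklore.
-/

noncomputable section

namespace Summit.CriticalPhenomena.Ising3DConformalLimit.Cruxes.DirectCorrelationStableTail.DiffusiveBranchIsNonsaturation

open MeasureTheory Filter Topology
open scoped BigOperators
open Literature.Probability.LatticeModels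

/-! ### The core estimate at a fixed nonzero momentum -/

set_option maxHeartbeats 400000 in
/-- **Core estimate.**  Fix `k ≠ 0` and put `Λ = C_α|k|₂^{-α}`.  Under the hypotheses of `stub_symbolIdentification`
(with the Riesz–Gaussian package specialised to this `k`, bound `B`), for every `δ > 0` and all large `R`:
`|c Λ R^α Σ_y m(y)(1 − cos(k·y/R)) − 1| ≤ δ`.  Proof: choose `ε₄`, then `t` (small enough for the Riesz–Gaussian
estimates at accuracy `ε₄` and with `τ = t^{-1/4}` large), then `ε₃` and `R₀` from the kernel estimate; write
`c Λ ψ_R − 1 = Σ_y Z(y)` with `Z = cΛR^α m(1 − cos) − m(Ψ_R(0) − Ψ_R)` (scale identity `Σ m(Ψ_R(0) − Ψ_R) = 1`), bound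
`|Z(y)| ≤ m(y)[c R^α bnd(y) + R^α ε₃ min(|y/R|², 1)]` by the three-region bound, and sum over boxes with the two mass
estimates. [folklore] -/
theorem symId_core {m G : Site 3 → ℝ} {α c C C' Cα B : ℝ} {R₁ : ℕ} {k : Fin 3 → ℝ}
    (hsum : Summable m) (hzero : (∑' y, m y) = 0) (hnn : ∀ y, y ≠ 0 → 0 ≤ m y)
    (hG0 : ∀ x, 0 ≤ G x) (hG1 : ∀ x, G x ≤ 1) (hGe : ∀ x, G (-x) = G x)
    (hconv : ∀ z : Site 3, (∑' y, m y * G (z - y)) = if z = 0 then -1 else 0)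
    (hα1 : 1 < α) (hα2 : α < 2) (hc : 0 < c) (hCα : 0 < Cα) (hB : 0 ≤ B) (hk : k ≠ 0)
    (hinf : ∀ R : ℕ, R₁ ≤ R → ∀ T : Finset (Site 3), (∀ y ∈ T, (R : ℝ) ≤ ‖y‖) →
      (R : ℝ) ^ α * ∑ y ∈ T, m y ≤ C)
    (hzer : ∀ R : ℕ, 1 ≤ R → ∑ y ∈ box 3 R, m y * (∑ i, ((y i : ℝ)) ^ 2) ≤ C' * (R : ℝ) ^ (2 - α))
    (hS2 : ∀ (m G : Site 3 → ℝ) (φ : (Fin 3 → ℝ) → ℝ) (R : ℝ) (Ψ : Site 3 → ℝ),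
      Summable m → (∑' y, m y) = 0 →
      (∀ x, 0 ≤ G x) → (∀ x, G x ≤ 1) → (∀ x, G (-x) = G x) →
      (∀ z : Site 3, (∑' y, m y * G (z - y)) = if z = 0 then -1 else 0) →
      (∀ v, φ (-v) = φ v) → (∀ v, |φ v| ≤ 1) → Summable (fun z : Site 3 => φ (fun i => (z i : ℝ) / R)) →
      (∀ y, Ψ y = ∑' z : Site 3, φ (fun i => (z i : ℝ) / R) * G (z - y)) →
      Summable (fun y => m y * (Ψ 0 - Ψ y)) ∧ (∑' y, m y * (Ψ 0 - Ψ y)) = φ 0 ∧ (∀ y, Ψ (-y) = Ψ y))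
    (hS3 : ∀ (t : ℝ) (k : Fin 3 → ℝ), 0 < t →
      (∀ R : ℕ, 1 ≤ R → Summable (fun z : Site 3 =>
        Real.exp (-(t * ∑ i, ((z i : ℝ) / R) ^ 2)) * Real.cos (∑ i, k i * ((z i : ℝ) / R)))) ∧
      ∀ ε : ℝ, 0 < ε → ∃ R₀ : ℕ, ∀ R : ℕ, R₀ ≤ R → ∀ (Ψ : Site 3 → ℝ) (D : (Fin 3 → ℝ) → ℝ),
        (∀ y, Ψ y = ∑' z : Site 3,
          (Real.exp (-(t * ∑ i, ((z i : ℝ) / R) ^ 2)) * Real.cos (∑ i, k i * ((z i : ℝ) / R))) * G (z - y)) →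
        (∀ u, D u = ∫ v : Fin 3 → ℝ, Real.sqrt (∑ i, v i ^ 2) ^ (α - 3) *
          (Real.exp (-(t * ∑ i, v i ^ 2)) * Real.cos (∑ i, k i * v i) -
            Real.exp (-(t * ∑ i, (v i + u i) ^ 2)) * Real.cos (∑ i, k i * (v i + u i)))) →
        ∀ y : Site 3, |(R : ℝ) ^ (-α) * (Ψ 0 - Ψ y) - c * D (fun i => (y i : ℝ) / R)| ≤
          ε * min (∑ i, ((y i : ℝ) / R) ^ 2) 1)
    (hS4k : ∀ ε : ℝ, 0 < ε → ∃ t₀ : ℝ, 0 < t₀ ∧ ∀ t : ℝ, 0 < t → t < t₀ → ∀ D : (Fin 3 → ℝ) → ℝ,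
      (∀ u, D u = ∫ v : Fin 3 → ℝ, Real.sqrt (∑ i, v i ^ 2) ^ (α - 3) *
        (Real.exp (-(t * ∑ i, v i ^ 2)) * Real.cos (∑ i, k i * v i) -
          Real.exp (-(t * ∑ i, (v i + u i) ^ 2)) * Real.cos (∑ i, k i * (v i + u i)))) →
      (∀ u : Fin 3 → ℝ, Real.sqrt (∑ i, u i ^ 2) ≤ t ^ (-(1 / 4 : ℝ)) →
        |D u - Cα * Real.sqrt (∑ i, k i ^ 2) ^ (-α) * (1 - Real.cos (∑ i, k i * u i))| ≤ ε) ∧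
      (∀ u : Fin 3 → ℝ, Real.sqrt (∑ i, u i ^ 2) ≤ 1 →
        |D u - Cα * Real.sqrt (∑ i, k i ^ 2) ^ (-α) * (1 - Real.cos (∑ i, k i * u i))| ≤ ε * ∑ i, u i ^ 2) ∧
      (∀ u : Fin 3 → ℝ, |D u| ≤ B))
    (δ : ℝ) (hδ : 0 < δ) :
    ∃ R₂ : ℕ, ∀ R : ℕ, R₂ ≤ R →
      |c * (Cα * Real.sqrt (∑ i, k i ^ 2) ^ (-α)) *
          ((R : ℝ) ^ α * ∑' y, m y * (1 - Real.cos (∑ i, k i * ((y i : ℝ) / R)))) - 1| ≤ δ := by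
  classical
  have hα0 : 0 ≤ α := by linarith
  have hC0 : 0 ≤ C := symId_C_nonneg hinf
  have hC'0 : 0 ≤ C' := symId_C'_nonneg hnn hzer
  -- `Λ = C_α |k|₂^{-α} > 0`
  have hEpos : 0 < Real.sqrt (∑ i, k i ^ 2) := by
    refine Real.sqrt_pos.2 ?_
    obtain ⟨i, hi⟩ : ∃ i, k i ≠ 0 := by
      by_contra h
      push Not at h
      exact hk (funext h)
    exact lt_of_lt_of_le (by positivity : 0 < k i ^ 2)
      (Finset.single_le_sum (f := fun j => k j ^ 2) (fun j _ => sq_nonneg _) (Finset.mem_univ i))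
  set Λ : ℝ := Cα * Real.sqrt (∑ i, k i ^ 2) ^ (-α) with hΛdef
  have hΛpos : 0 < Λ := mul_pos hCα (Real.rpow_pos_of_pos hEpos _)
  -- Step 1: `ε₄` and the Riesz–Gaussian scale `t₀`
  set K₂ : ℝ := c * (C' + C) with hK₂
  have hK₂0 : 0 ≤ K₂ := by positivity
  set ε₄ : ℝ := δ / (3 * (K₂ + 1)) with hε₄
  have hε₄pos : 0 < ε₄ := by positivity
  have hK₂ε : K₂ * ε₄ ≤ δ / 3 := by
    rw [hε₄, mul_div_assoc']
    rw [div_le_div_iff₀ (by positivity) (by positivity)]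
    nlinarith
  obtain ⟨t₀, ht₀, hS4t⟩ := hS4k ε₄ hε₄pos
  -- Step 2: `τ₀` and `t`
  set K₃ : ℝ := c * (B + 2 * Λ) * C * (2 : ℝ) ^ α with hK₃
  have hK₃0 : 0 ≤ K₃ := by positivity
  set τ₀ : ℝ := max 2 (3 * (K₃ + 1) / δ) with hτ₀
  have hτ₀2 : 2 ≤ τ₀ := le_max_left _ _
  have hτ₀pos : 0 < τ₀ := by linarith
  have hK₃τ : K₃ * τ₀⁻¹ ≤ δ / 3 := by
    have h1 : 3 * (K₃ + 1) / δ ≤ τ₀ := le_max_right _ _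
    rw [div_le_iff₀ hδ] at h1
    rw [← div_eq_mul_inv, div_le_div_iff₀ hτ₀pos (by norm_num : (0 : ℝ) < 3)]
    nlinarith
  set t : ℝ := min (t₀ / 2) (τ₀ ^ (-(4 : ℝ))) with htdef
  have htpos : 0 < t := lt_min (by linarith) (Real.rpow_pos_of_pos hτ₀pos _)
  have htlt : t < t₀ := lt_of_le_of_lt (min_le_left _ _) (by linarith)
  set τ : ℝ := t ^ (-(1 / 4 : ℝ)) with hτdef
  have hττ₀ : τ₀ ≤ τ := by
    have h1 : t ≤ τ₀ ^ (-(4 : ℝ)) := min_le_right _ _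
    have h2 : (τ₀ ^ (-(4 : ℝ))) ^ (-(1 / 4 : ℝ)) ≤ t ^ (-(1 / 4 : ℝ)) :=
      Real.rpow_le_rpow_of_nonpos htpos h1 (by norm_num)
    have h3 : (τ₀ ^ (-(4 : ℝ))) ^ (-(1 / 4 : ℝ)) = τ₀ := by
      rw [← Real.rpow_mul hτ₀pos.le]
      norm_num
    rw [h3] at h2
    exact h2
  have hτ2 : 2 ≤ τ := hτ₀2.trans hττ₀
  have hτpos : 0 < τ := by linarith
  have hK₃τ' : K₃ * τ ^ (-α) ≤ δ / 3 := by
    have h1 : τ ^ (-α) ≤ τ ^ (-(1 : ℝ)) :=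
      Real.rpow_le_rpow_of_exponent_le (by linarith) (by linarith)
    rw [Real.rpow_neg_one] at h1
    have h2 : τ⁻¹ ≤ τ₀⁻¹ := by
      rw [inv_le_inv₀ hτpos hτ₀pos]
      exact hττ₀
    calc K₃ * τ ^ (-α) ≤ K₃ * τ₀⁻¹ := mul_le_mul_of_nonneg_left (h1.trans h2) hK₃0
      _ ≤ δ / 3 := hK₃τ
  -- Step 3: the Riesz–Gaussian estimates at this `t`
  set D : (Fin 3 → ℝ) → ℝ := fun u => ∫ v : Fin 3 → ℝ, Real.sqrt (∑ i, v i ^ 2) ^ (α - 3) *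
    (Real.exp (-(t * ∑ i, v i ^ 2)) * Real.cos (∑ i, k i * v i) -
      Real.exp (-(t * ∑ i, (v i + u i) ^ 2)) * Real.cos (∑ i, k i * (v i + u i))) with hDdef
  obtain ⟨ha, hb, hcB⟩ := hS4t t htpos htlt D (fun u => rfl)
  -- Step 4: `ε₃` and the kernel estimate
  set K₁ : ℝ := C' + C with hK₁
  have hK₁0 : 0 ≤ K₁ := by positivity
  set ε₃ : ℝ := δ / (3 * (K₁ + 1)) with hε₃
  have hε₃pos : 0 < ε₃ := by positivity
  have hK₁ε : K₁ * ε₃ ≤ δ / 3 := by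
    rw [hε₃, mul_div_assoc']
    rw [div_le_div_iff₀ (by positivity) (by positivity)]
    nlinarith
  obtain ⟨hsumφ, hS3'⟩ := hS3 t k htpos
  obtain ⟨R₀, hR₀⟩ := hS3' ε₃ hε₃pos
  -- Step 5: the threshold
  refine ⟨max R₀ (max R₁ 1), fun R hR => ?_⟩
  have hRR₀ : R₀ ≤ R := le_trans (le_max_left _ _) hR
  have hRR₁ : R₁ ≤ R := le_trans ((le_max_left _ _).trans (le_max_right _ _)) hR
  have hR1 : 1 ≤ R := le_trans ((le_max_right _ _).trans (le_max_right _ _)) hR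
  have hRpos : (0 : ℝ) < R := by exact_mod_cast hR1
  have hRα : (0 : ℝ) < (R : ℝ) ^ α := Real.rpow_pos_of_pos hRpos α
  have hRR : (R : ℝ) ^ α * (R : ℝ) ^ (-α) = 1 := by
    rw [Real.rpow_neg hRpos.le, mul_inv_cancel₀ hRα.ne']
  -- the smeared kernel at scale `R`, the kernel estimate and the scale identity
  set Ψ : Site 3 → ℝ := fun y => ∑' z : Site 3,
    (Real.exp (-(t * ∑ i, ((z i : ℝ) / R) ^ 2)) * Real.cos (∑ i, k i * ((z i : ℝ) / R))) * G (z - y) with hΨdef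
  have hE3 : ∀ y : Site 3, |(R : ℝ) ^ (-α) * (Ψ 0 - Ψ y) - c * D (fun i => (y i : ℝ) / R)| ≤
      ε₃ * min (∑ i, ((y i : ℝ) / R) ^ 2) 1 := hR₀ R hRR₀ Ψ D (fun y => rfl) (fun u => rfl)
  have hφeven : ∀ v : Fin 3 → ℝ, (Real.exp (-(t * ∑ i, (-v) i ^ 2)) * Real.cos (∑ i, k i * (-v) i)) =
      Real.exp (-(t * ∑ i, v i ^ 2)) * Real.cos (∑ i, k i * v i) := by
    intro v
    simp only [Pi.neg_apply, neg_sq, mul_neg, Finset.sum_neg_distrib, Real.cos_neg]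
  have hφbdd : ∀ v : Fin 3 → ℝ, |Real.exp (-(t * ∑ i, v i ^ 2)) * Real.cos (∑ i, k i * v i)| ≤ 1 := by
    intro v
    rw [abs_mul, Real.abs_exp]
    have h1 : Real.exp (-(t * ∑ i, v i ^ 2)) ≤ 1 := by
      rw [Real.exp_le_one_iff, neg_nonpos]
      exact mul_nonneg htpos.le (Finset.sum_nonneg fun i _ => sq_nonneg _)
    have h2 := Real.abs_cos_le_one (∑ i, k i * v i)
    calc Real.exp (-(t * ∑ i, v i ^ 2)) * |Real.cos (∑ i, k i * v i)| ≤ 1 * 1 :=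
        mul_le_mul h1 h2 (abs_nonneg _) zero_le_one
      _ = 1 := one_mul _
  obtain ⟨hsumS2, hid, -⟩ := hS2 m G (fun v => Real.exp (-(t * ∑ i, v i ^ 2)) * Real.cos (∑ i, k i * v i))
    R Ψ hsum hzero hG0 hG1 hGe hconv hφeven hφbdd (hsumφ R hR1) (fun y => rfl)
  have hid1 : (∑' y, m y * (Ψ 0 - Ψ y)) = 1 := by
    rw [hid]; simp
  clear hS2 hS3 hS3' hS4k hS4t hR₀ hid hconv hzero hφeven hφbdd hsumφ
  -- Step 6: `c Λ ψ_R − 1 = Σ Z`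
  have hsumcos : Summable (fun y : Site 3 => m y * (1 - Real.cos (∑ i, k i * ((y i : ℝ) / R)))) := by
    refine Summable.of_norm_bounded (hsum.abs.mul_right 2) fun y => ?_
    rw [Real.norm_eq_abs, abs_mul]
    refine mul_le_mul_of_nonneg_left ?_ (abs_nonneg _)
    have h1 := Real.cos_le_one (∑ i, k i * ((y i : ℝ) / R))
    have h2 := Real.neg_one_le_cos (∑ i, k i * ((y i : ℝ) / R))
    rw [abs_le]; constructor <;> linarith
  set Z : Site 3 → ℝ := fun y => c * Λ * (R : ℝ) ^ α * (m y * (1 - Real.cos (∑ i, k i * ((y i : ℝ) / R)))) -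
    m y * (Ψ 0 - Ψ y) with hZdef
  have hZsum : Summable Z := (hsumcos.mul_left _).sub hsumS2
  have hZtsum : (∑' y, Z y) = c * (Cα * Real.sqrt (∑ i, k i ^ 2) ^ (-α)) *
      ((R : ℝ) ^ α * ∑' y, m y * (1 - Real.cos (∑ i, k i * ((y i : ℝ) / R)))) - 1 := by
    rw [hZdef, (hsumcos.mul_left _).tsum_sub hsumS2, tsum_mul_left, hid1]
    ring
  rw [← hZtsum]
  refine symId_abs_tsum_le_of_sum_box_le hZsum (Filter.Eventually.of_forall fun L => ?_)
  -- Step 7: the pointwise bound on `|Z|`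
  set M₃ : ℕ := ⌊τ * R / 2⌋₊ with hM₃def
  have hM₃le : (M₃ : ℝ) ≤ τ * R / 2 := Nat.floor_le (by positivity)
  have hM₃lt : τ * R / 2 < (M₃ : ℝ) + 1 := Nat.lt_floor_add_one _
  have hRM₃ : R ≤ M₃ := by
    rw [hM₃def]
    refine Nat.le_floor ?_
    have : (R : ℝ) * 2 ≤ τ * R := by nlinarith
    linarith
  have hpt : ∀ y : Site 3, |Z y| ≤ m y * (c * (R : ℝ) ^ α *
      (if y ∈ box 3 R then ε₄ * (∑ i, ((y i : ℝ)) ^ 2) / (R : ℝ) ^ 2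
        else if y ∈ box 3 M₃ then ε₄ else ε₄ + (B + 2 * Λ)) +
      (R : ℝ) ^ α * (ε₃ * min (∑ i, ((y i : ℝ) / R) ^ 2) 1)) := by
    intro y
    by_cases hy0 : y = 0
    · subst hy0
      have hZ0 : Z 0 = 0 := by simp [hZdef]
      rw [hZ0, abs_zero]
      simp
    have hmy : 0 ≤ m y := hnn y hy0
    have h1 := symId_pointwise (D := D) (k := k) hR1 hτ2 hM₃le hΛpos.le hε₄pos.le ha hb hcB y
    have h2 := hE3 y
    -- `Z y = m y · [R^α c (Λ(1 − cos) − D u) + (R^α c D u − (Ψ 0 − Ψ y))]`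
    have hZy : Z y = m y * ((R : ℝ) ^ α * c * (Λ * (1 - Real.cos (∑ i, k i * ((y i : ℝ) / R))) -
        D (fun i => (y i : ℝ) / R)) + ((R : ℝ) ^ α * (c * D (fun i => (y i : ℝ) / R)) - (Ψ 0 - Ψ y))) := by
      simp only [hZdef]; ring
    have h2' : |(R : ℝ) ^ α * (c * D (fun i => (y i : ℝ) / R)) - (Ψ 0 - Ψ y)| ≤
        (R : ℝ) ^ α * (ε₃ * min (∑ i, ((y i : ℝ) / R) ^ 2) 1) := by
      have aux : (R : ℝ) ^ α * ((R : ℝ) ^ (-α) * (Ψ 0 - Ψ y)) = Ψ 0 - Ψ y := by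
        rw [← mul_assoc, hRR, one_mul]
      have e : (R : ℝ) ^ α * (c * D (fun i => (y i : ℝ) / R)) - (Ψ 0 - Ψ y) =
          -((R : ℝ) ^ α * ((R : ℝ) ^ (-α) * (Ψ 0 - Ψ y) - c * D (fun i => (y i : ℝ) / R))) := by
        rw [mul_sub ((R : ℝ) ^ α) ((R : ℝ) ^ (-α) * (Ψ 0 - Ψ y)), aux]
        ring
      rw [e, abs_neg, abs_mul, abs_of_pos hRα]
      exact mul_le_mul_of_nonneg_left h2 hRα.le
    have h1' : |(R : ℝ) ^ α * c * (Λ * (1 - Real.cos (∑ i, k i * ((y i : ℝ) / R))) -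
        D (fun i => (y i : ℝ) / R))| ≤ c * (R : ℝ) ^ α *
        (if y ∈ box 3 R then ε₄ * (∑ i, ((y i : ℝ)) ^ 2) / (R : ℝ) ^ 2
          else if y ∈ box 3 M₃ then ε₄ else ε₄ + (B + 2 * Λ)) := by
      rw [abs_mul, abs_of_pos (by positivity : (0 : ℝ) < (R : ℝ) ^ α * c), abs_sub_comm,
        show (R : ℝ) ^ α * c = c * (R : ℝ) ^ α by ring]
      exact mul_le_mul_of_nonneg_left h1 (by positivity)
    rw [hZy, abs_mul, abs_of_nonneg hmy]
    exact mul_le_mul_of_nonneg_left ((abs_add_le _ _).trans (add_le_add h1' h2')) hmy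
  -- Step 8: sum over the box and use the two mass estimates
  have hBΛ : 0 ≤ B + 2 * Λ := by positivity
  calc ∑ y ∈ box 3 L, |Z y|
      ≤ ∑ y ∈ box 3 L, m y * (c * (R : ℝ) ^ α *
          (if y ∈ box 3 R then ε₄ * (∑ i, ((y i : ℝ)) ^ 2) / (R : ℝ) ^ 2
            else if y ∈ box 3 M₃ then ε₄ else ε₄ + (B + 2 * Λ)) +
          (R : ℝ) ^ α * (ε₃ * min (∑ i, ((y i : ℝ) / R) ^ 2) 1)) := Finset.sum_le_sum fun y _ => hpt y
    _ = c * (R : ℝ) ^ α * ∑ y ∈ box 3 L, m y *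
          (if y ∈ box 3 R then ε₄ * (∑ i, ((y i : ℝ)) ^ 2) / (R : ℝ) ^ 2
            else if y ∈ box 3 M₃ then ε₄ else ε₄ + (B + 2 * Λ)) +
        (R : ℝ) ^ α * ε₃ * ∑ y ∈ box 3 L, m y * min (∑ i, ((y i : ℝ) / R) ^ 2) 1 := by
          rw [Finset.mul_sum, Finset.mul_sum, ← Finset.sum_add_distrib]
          refine Finset.sum_congr rfl fun y _ => ?_
          ring
    _ ≤ c * (R : ℝ) ^ α * (ε₄ * ((C' + C) * (R : ℝ) ^ (-α)) + (B + 2 * Λ) * (C * ((M₃ : ℝ) + 1) ^ (-α))) +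
        (R : ℝ) ^ α * ε₃ * ((C' + C) * (R : ℝ) ^ (-α)) := by
          refine add_le_add (mul_le_mul_of_nonneg_left
            (symId_sum_bnd_le hnn hα0 hinf hzer hR1 hRR₁ hRM₃ hε₄pos.le hBΛ L) (by positivity))
            (mul_le_mul_of_nonneg_left (symId_sum_min_le hnn hα0 hinf hzer hR1 hRR₁ L) (by positivity))
    _ ≤ δ := by
          -- `R^α R^{-α} = 1`, `R^α (M₃+1)^{-α} ≤ 2^α τ^{-α}`
          have e1 : (R : ℝ) ^ α * (R : ℝ) ^ (-α) = 1 := hRR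
          have e2 : (R : ℝ) ^ α * ((M₃ : ℝ) + 1) ^ (-α) ≤ (2 : ℝ) ^ α * τ ^ (-α) := by
            have hpos : 0 < τ * R / 2 := by positivity
            have h1 : ((M₃ : ℝ) + 1) ^ (-α) ≤ (τ * R / 2) ^ (-α) :=
              Real.rpow_le_rpow_of_nonpos hpos hM₃lt.le (by linarith)
            have h2 : (τ * R / 2) ^ (-α) = τ ^ (-α) * (R : ℝ) ^ (-α) * (2 : ℝ) ^ α := by
              have h20 : (0 : ℝ) ≤ 2 := by norm_num
              rw [div_eq_mul_inv, Real.mul_rpow (mul_nonneg hτpos.le hRpos.le) (inv_nonneg.2 h20),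
                Real.mul_rpow hτpos.le hRpos.le, Real.inv_rpow h20, Real.rpow_neg h20, inv_inv]
            calc (R : ℝ) ^ α * ((M₃ : ℝ) + 1) ^ (-α) ≤ (R : ℝ) ^ α * (τ * R / 2) ^ (-α) :=
                  mul_le_mul_of_nonneg_left h1 hRα.le
              _ = (2 : ℝ) ^ α * τ ^ (-α) * ((R : ℝ) ^ α * (R : ℝ) ^ (-α)) := by rw [h2]; ring
              _ = (2 : ℝ) ^ α * τ ^ (-α) := by rw [e1, mul_one]
          have t1 : c * (R : ℝ) ^ α * (ε₄ * ((C' + C) * (R : ℝ) ^ (-α))) = K₂ * ε₄ := by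
            calc c * (R : ℝ) ^ α * (ε₄ * ((C' + C) * (R : ℝ) ^ (-α)))
                = c * (C' + C) * ε₄ * ((R : ℝ) ^ α * (R : ℝ) ^ (-α)) := by ring
              _ = K₂ * ε₄ := by rw [e1, mul_one]
          have t2 : c * (R : ℝ) ^ α * ((B + 2 * Λ) * (C * ((M₃ : ℝ) + 1) ^ (-α))) ≤ K₃ * τ ^ (-α) := by
            calc c * (R : ℝ) ^ α * ((B + 2 * Λ) * (C * ((M₃ : ℝ) + 1) ^ (-α)))
                = c * (B + 2 * Λ) * C * ((R : ℝ) ^ α * ((M₃ : ℝ) + 1) ^ (-α)) := by ring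
              _ ≤ c * (B + 2 * Λ) * C * ((2 : ℝ) ^ α * τ ^ (-α)) :=
                  mul_le_mul_of_nonneg_left e2 (by positivity)
              _ = K₃ * τ ^ (-α) := by rw [hK₃]; ring
          have t3 : (R : ℝ) ^ α * ε₃ * ((C' + C) * (R : ℝ) ^ (-α)) = K₁ * ε₃ := by
            calc (R : ℝ) ^ α * ε₃ * ((C' + C) * (R : ℝ) ^ (-α))
                = (C' + C) * ε₃ * ((R : ℝ) ^ α * (R : ℝ) ^ (-α)) := by ring
              _ = K₁ * ε₃ := by rw [e1, mul_one]
          rw [mul_add, t1, t3]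
          linarith [t2, hK₂ε, hK₃τ', hK₁ε]

/-- **Registered sub-goal `stub_symbolIdentification_auxCore`** (= `symId_core` with explicit binders): the core
estimate `|c Λ R^α Σ_y m(y)(1 − cos(k·y/R)) − 1| ≤ δ` for large `R`, at a fixed momentum `k ≠ 0`. [folklore] -/
theorem stub_symbolIdentification_auxCore :
    ∀ (m G : Site 3 → ℝ) (α c C C' Cα B : ℝ) (R₁ : ℕ) (k : Fin 3 → ℝ), Summable m → (∑' y, m y) = 0 → (∀ y, y ≠
      0 → 0 ≤ m y) → (∀ x, 0 ≤ G x) → (∀ x, G x ≤ 1) → (∀ x, G (-x) = G x) → (∀ z : Site 3, (∑' y, m y * G (z -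
      y)) = if z = 0 then -1 else 0) → 1 < α → α < 2 → 0 < c → 0 < Cα → 0 ≤ B → k ≠ 0 → (∀ R : ℕ, R₁ ≤ R → ∀ T
      : Finset (Site 3), (∀ y ∈ T, (R : ℝ) ≤ ‖y‖) → (R : ℝ) ^ α * ∑ y ∈ T, m y ≤ C) → (∀ R : ℕ, 1 ≤ R → ∑ y ∈
      box 3 R, m y * (∑ i, ((y i : ℝ)) ^ 2) ≤ C' * (R : ℝ) ^ (2 - α)) → (∀ (m G : Site 3 → ℝ) (φ : (Fin 3 → ℝ)
      → ℝ) (R : ℝ) (Ψ : Site 3 → ℝ), Summable m → (∑' y, m y) = 0 → (∀ x, 0 ≤ G x) → (∀ x, G x ≤ 1) → (∀ x, G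
      (-x) = G x) → (∀ z : Site 3, (∑' y, m y * G (z - y)) = if z = 0 then -1 else 0) → (∀ v, φ (-v) = φ v) →
      (∀ v, |φ v| ≤ 1) → Summable (fun z : Site 3 => φ (fun i => (z i : ℝ) / R)) → (∀ y, Ψ y = ∑' z : Site 3, φ
      (fun i => (z i : ℝ) / R) * G (z - y)) → Summable (fun y => m y * (Ψ 0 - Ψ y)) ∧ (∑' y, m y * (Ψ 0 - Ψ y))
      = φ 0 ∧ (∀ y, Ψ (-y) = Ψ y)) → (∀ (t : ℝ) (k : Fin 3 → ℝ), 0 < t → (∀ R : ℕ, 1 ≤ R → Summable (fun z :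
      Site 3 => Real.exp (-(t * ∑ i, ((z i : ℝ) / R) ^ 2)) * Real.cos (∑ i, k i * ((z i : ℝ) / R)))) ∧ ∀ ε : ℝ,
      0 < ε → ∃ R₀ : ℕ, ∀ R : ℕ, R₀ ≤ R → ∀ (Ψ : Site 3 → ℝ) (D : (Fin 3 → ℝ) → ℝ), (∀ y, Ψ y = ∑' z : Site 3,
      (Real.exp (-(t * ∑ i, ((z i : ℝ) / R) ^ 2)) * Real.cos (∑ i, k i * ((z i : ℝ) / R))) * G (z - y)) → (∀ u,
      D u = ∫ v : Fin 3 → ℝ, Real.sqrt (∑ i, v i ^ 2) ^ (α - 3) * (Real.exp (-(t * ∑ i, v i ^ 2)) * Real.cos (∑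
      i, k i * v i) - Real.exp (-(t * ∑ i, (v i + u i) ^ 2)) * Real.cos (∑ i, k i * (v i + u i)))) → ∀ y : Site
      3, |(R : ℝ) ^ (-α) * (Ψ 0 - Ψ y) - c * D (fun i => (y i : ℝ) / R)| ≤ ε * min (∑ i, ((y i : ℝ) / R) ^ 2)
      1) → (∀ ε : ℝ, 0 < ε → ∃ t₀ : ℝ, 0 < t₀ ∧ ∀ t : ℝ, 0 < t → t < t₀ → ∀ D : (Fin 3 → ℝ) → ℝ, (∀ u, D u = ∫
      v : Fin 3 → ℝ, Real.sqrt (∑ i, v i ^ 2) ^ (α - 3) * (Real.exp (-(t * ∑ i, v i ^ 2)) * Real.cos (∑ i, k i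
      * v i) - Real.exp (-(t * ∑ i, (v i + u i) ^ 2)) * Real.cos (∑ i, k i * (v i + u i)))) → (∀ u : Fin 3 → ℝ,
      Real.sqrt (∑ i, u i ^ 2) ≤ t ^ (-(1 / 4 : ℝ)) → |D u - Cα * Real.sqrt (∑ i, k i ^ 2) ^ (-α) * (1 -
      Real.cos (∑ i, k i * u i))| ≤ ε) ∧ (∀ u : Fin 3 → ℝ, Real.sqrt (∑ i, u i ^ 2) ≤ 1 → |D u - Cα * Real.sqrt
      (∑ i, k i ^ 2) ^ (-α) * (1 - Real.cos (∑ i, k i * u i))| ≤ ε * ∑ i, u i ^ 2) ∧ (∀ u : Fin 3 → ℝ, |D u| ≤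
      B)) → ∀ δ : ℝ, 0 < δ → ∃ R₂ : ℕ, ∀ R : ℕ, R₂ ≤ R → |c * (Cα * Real.sqrt (∑ i, k i ^ 2) ^ (-α)) * ((R : ℝ)
      ^ α * ∑' y, m y * (1 - Real.cos (∑ i, k i * ((y i : ℝ) / R)))) - 1| ≤ δ :=
  fun _ _ _ _ _ _ _ _ _ _ hsum hzero hnn hG0 hG1 hGe hconv hα1 hα2 hc hCα hB hk hinf hzer hS2 hS3 hS4k δ hδ =>
    symId_core hsum hzero hnn hG0 hG1 hGe hconv hα1 hα2 hc hCα hB hk hinf hzer hS2 hS3 hS4k δ hδ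

end Summit.CriticalPhenomena.Ising3DConformalLimit.Cruxes.DirectCorrelationStableTail.DiffusiveBranchIsNonsaturation

end
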